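import Summits.HodgeConjecture.HodgeConjecture.Theorems.A3Liu413ClassWeights
import Summits.HodgeConjecture.HodgeConjecture.Theorems.A3Liu413LevelSummand
import Summits.HodgeConjecture.HodgeConjecture.Theorems.A3Liu413TowerFormGlue
import Summits.HodgeConjecture.HodgeConjecture.Theorems.A3Liu413TowerSmooth
import Literature.NumberTheory.Automorphic.MatrixCoefficients
import HarnessLib

/-!
# `h413` stub (b): the weighted LEVEL FORMS and the invariant Hermitian form on the tower — `towerRep` is unitarizable

Support file for the crux `H413` (stmt-HodgeConjecture-24833), line `a3-liu413`, stub `stub_unitarizableAtPin` (A-p10 SPEC-b6-Assembly-v2, file F2).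
KERNEL ONLY (theorems; no definition, no named fact; the Kähler-class system `hΩ : BallQuotientKaehlerClassSystem` of row B3-25 is an explicit
HYPOTHESIS, as in `A3Liu413LevelSummand`).

For a family `B_Δ` of Hermitian positive-definite forms on `H¹(X_Δ(ℂ); ℂ)` compatible with the rational translates (conclusions (S1)–(S4) of
`A3Liu413LevelSummand`, proved there for the `ω`-normalised Hodge–Riemann forms) the WEIGHTED LEVEL SUM on `H_K = towerLevel Γ`
  `S_Γ(c, c') := Σ_{q ∈ U(V)(L₀)\U(V)(𝔸_f)/K_Γ} w_Γ(q) · B_{Γ_q}(c_q, c'_q)`,   `w_Γ = classWeight (ρ V).range K_f(3) K_Γ`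
(§1) is compatible with `restrictLevel` ((S2)+(S1)+(W2)), with the translations `translate g` HONESTLY ((S3)+(W3)+mass trick: `classWeight_level_conj`),
Hermitian and positive definite; (§2) packaged as sesquilinear maps and glued along the colimit (`exists_invariantForm_towerRep`, p599036) it gives a
`U(V)(𝔸_f)`-invariant positive-definite Hermitian form on the tower: **`isUnitarizable_towerRep`**, and (junction `ofModule'_tower_eq_towerRep`)
**`isUnitarizable_ofModule'_tower`** — the field `rhoB τ'` of the `h413` datum is unitarizable, conditional on `hΩ` only.
HC_CM is proved only modulo the printed citations until rung 0 closes; this file discharges nothing of them.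
-/

noncomputable section

open scoped Pointwise ComplexConjugate
open NumberField IsDedekindDomain
open Literature.AlgebraicGeometry.ShimuraVarieties
open Literature.AlgebraicGeometry.HodgeTheory
open Literature.NumberTheory.Automorphic
open Literature.NumberTheory.Automorphic.PicardCM
open Literature.NumberTheory.Transcendental (Arapura2012_Cor_15_4_6)
open Literature.GroupTheory
open HodgeCM.Adelic HodgeCM.PerL34.AdelicUnitaryFactorisation HodgeCM.PerL34.Godement

namespace HodgeCM

open HodgeCM.Model.LevelTranslate HodgeCM.Model.TowerCarrier

namespace Model.TowerLevel

variable (hHD : exists_isReal_hodgeModel) (hI : hodgePQ_independent_of_hodgeModel)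
  (hU : BallQuotientUniformisedDatum) (h₃ : CMAbelianVarietyRealised) (hA : Arapura2012_Cor_15_4_6)
variable {L : CMField} {ι₁ : L →+* ℂ} (V : HermSpace3 L ι₁)
variable (B : ∀ Δ : Level V, Coh hHD hI hU h₃ Δ 1 →ₗ⋆[ℂ] Coh hHD hI hU h₃ Δ 1 →ₗ[ℂ] ℂ)

/-! ## §1 The weighted level sums: restriction, translation, symmetry, positivity -/

/-- **(hres) The weighted level sums are compatible with `restrictLevel`** (`Γ' ≤ Γ`): termwise (S2), regroup the `K_{Γ'}`-classes along the fibres of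
`U\G/K_{Γ'} → U\G/K_Γ`, inside a fibre the `B`-term is constant (S1), and the `Γ'`-weights of a fibre add up to the `Γ`-weight (W2).
[cite: ShimuraIATAF1971, §3.1 Prop. 3.1 and §3.3] -/
theorem levelSum_restrict (hL : Module.finrank ℚ L ≠ 2) (Δ₀ : Level V)
    (hS1 : ∀ {Γ : Level V} (hΓ : Γ.BelowConjThree) (c c' : towerLevel hHD hI hU h₃ hA Γ hΓ) {γ : ↥(Urat V)} {x x' : V.adelicFin},
      Rel Γ γ x x' → B (Γ.conj x hΓ) ((c : Π h, W hHD hI hU h₃ Γ hΓ h) x) ((c' : Π h, W hHD hI hU h₃ Γ hΓ h) x) =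
        B (Γ.conj x' hΓ) ((c : Π h, W hHD hI hU h₃ Γ hΓ h) x') ((c' : Π h, W hHD hI hU h₃ Γ hΓ h) x'))
    (hS2 : ∀ {Γ Γ' : Level V} (hle : Γ' ≤ Γ) (hΓ : Γ.BelowConjThree) (hΓ' : Γ'.BelowConjThree)
      (c c' : towerLevel hHD hI hU h₃ hA Γ hΓ) (x : V.adelicFin),
      B (Γ'.conj x hΓ') ((restrictLevel hHD hI hU h₃ hA hle hΓ hΓ' c : Π h, W hHD hI hU h₃ Γ' hΓ' h) x)
          ((restrictLevel hHD hI hU h₃ hA hle hΓ hΓ' c' : Π h, W hHD hI hU h₃ Γ' hΓ' h) x) =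
        B (Γ.conj x hΓ) ((c : Π h, W hHD hI hU h₃ Γ hΓ h) x) ((c' : Π h, W hHD hI hU h₃ Γ hΓ h) x))
    {Γ Γ' : Level V} (hle : Γ' ≤ Γ) (hΓ : Γ.BelowConjThree) (hΓ' : Γ'.BelowConjThree) (c c' : towerLevel hHD hI hU h₃ hA Γ hΓ)
    [Fintype (DoubleCoset.Quotient (((ρ V).range : Subgroup V.adelicFin) : Set V.adelicFin) (Γ.K : Set V.adelicFin))]
    [Fintype (DoubleCoset.Quotient (((ρ V).range : Subgroup V.adelicFin) : Set V.adelicFin) (Γ'.K : Set V.adelicFin))] :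
    ∑ q' : DoubleCoset.Quotient (((ρ V).range : Subgroup V.adelicFin) : Set V.adelicFin) (Γ'.K : Set V.adelicFin),
        ((classWeight (ρ V).range Δ₀.K Γ'.K q'.out : ℚ) : ℂ) *
          B (Γ'.conj q'.out hΓ') ((restrictLevel hHD hI hU h₃ hA hle hΓ hΓ' c : Π h, W hHD hI hU h₃ Γ' hΓ' h) q'.out)
            ((restrictLevel hHD hI hU h₃ hA hle hΓ hΓ' c' : Π h, W hHD hI hU h₃ Γ' hΓ' h) q'.out) =
      ∑ q : DoubleCoset.Quotient (((ρ V).range : Subgroup V.adelicFin) : Set V.adelicFin) (Γ.K : Set V.adelicFin),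
        ((classWeight (ρ V).range Δ₀.K Γ.K q.out : ℚ) : ℂ) *
          B (Γ.conj q.out hΓ) ((c : Π h, W hHD hI hU h₃ Γ hΓ h) q.out) ((c' : Π h, W hHD hI hU h₃ Γ hΓ h) q.out) := by
  classical
  -- (S2) termwise
  have h1 : ∀ q' : DoubleCoset.Quotient (((ρ V).range : Subgroup V.adelicFin) : Set V.adelicFin) (Γ'.K : Set V.adelicFin),
      ((classWeight (ρ V).range Δ₀.K Γ'.K q'.out : ℚ) : ℂ) *
          B (Γ'.conj q'.out hΓ') ((restrictLevel hHD hI hU h₃ hA hle hΓ hΓ' c : Π h, W hHD hI hU h₃ Γ' hΓ' h) q'.out)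
            ((restrictLevel hHD hI hU h₃ hA hle hΓ hΓ' c' : Π h, W hHD hI hU h₃ Γ' hΓ' h) q'.out) =
        ((classWeight (ρ V).range Δ₀.K Γ'.K q'.out : ℚ) : ℂ) *
          B (Γ.conj q'.out hΓ) ((c : Π h, W hHD hI hU h₃ Γ hΓ h) q'.out) ((c' : Π h, W hHD hI hU h₃ Γ hΓ h) q'.out) := by
    intro q'
    rw [hS2 hle hΓ hΓ' c c' q'.out]
  rw [Finset.sum_congr rfl (fun q' _ => h1 q'),
    sum_quotient_eq_sum_fibre (ρ V).range Γ.K Γ'.K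
      (fun q' => ((classWeight (ρ V).range Δ₀.K Γ'.K q'.out : ℚ) : ℂ) *
        B (Γ.conj q'.out hΓ) ((c : Π h, W hHD hI hU h₃ Γ hΓ h) q'.out) ((c' : Π h, W hHD hI hU h₃ Γ hΓ h) q'.out))]
  refine Finset.sum_congr rfl (fun q _ => ?_)
  -- inside the fibre of `q` the `B`-term is constant, by (S1)
  have h2 : ∀ q' ∈ Finset.univ.filter
      (fun q' : DoubleCoset.Quotient (((ρ V).range : Subgroup V.adelicFin) : Set V.adelicFin) (Γ'.K : Set V.adelicFin) =>
        DoubleCoset.mk (ρ V).range Γ.K q'.out = DoubleCoset.mk (ρ V).range Γ.K q.out),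
      ((classWeight (ρ V).range Δ₀.K Γ'.K q'.out : ℚ) : ℂ) *
          B (Γ.conj q'.out hΓ) ((c : Π h, W hHD hI hU h₃ Γ hΓ h) q'.out) ((c' : Π h, W hHD hI hU h₃ Γ hΓ h) q'.out) =
        ((classWeight (ρ V).range Δ₀.K Γ'.K q'.out : ℚ) : ℂ) *
          B (Γ.conj q.out hΓ) ((c : Π h, W hHD hI hU h₃ Γ hΓ h) q.out) ((c' : Π h, W hHD hI hU h₃ Γ hΓ h) q.out) := by
    intro q' hq'
    rw [Finset.mem_filter] at hq'
    obtain ⟨u, hu, k, hk, he⟩ := (DoubleCoset.eq _ _ q'.out q.out).mp hq'.2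
    obtain ⟨γ, rfl⟩ := hu
    have r : Rel Γ γ q'.out q.out := ⟨k, hk, he⟩
    rw [hS1 hΓ c c' r]
  rw [Finset.sum_congr rfl h2, ← Finset.sum_mul]
  congr 1
  have h3 := sum_fibre_classWeight_level V hL Δ₀ hle q.out
  exact_mod_cast h3

/-- **(htr) The weighted level sums are HONESTLY invariant under the translations** `translate g : H_K → H_{gKg⁻¹}`: termwise (S3) and
`w_{Γ.conj g}(y) = w_Γ(y g)` (`classWeight_level_conj`: (W3) and the mass trick), then re-index the class set along `y ↦ y g`
(`sum_classSet_translate`, the summand being a class function by (W1) and (S1)). [cite: ShimuraIATAF1971, §3.3 Prop. 3.6] [cite: PlatonovRapinchuk1994, §8.1] -/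
theorem levelSum_translate (hL : Module.finrank ℚ L ≠ 2) (Δ₀ : Level V)
    (hS1 : ∀ {Γ : Level V} (hΓ : Γ.BelowConjThree) (c c' : towerLevel hHD hI hU h₃ hA Γ hΓ) {γ : ↥(Urat V)} {x x' : V.adelicFin},
      Rel Γ γ x x' → B (Γ.conj x hΓ) ((c : Π h, W hHD hI hU h₃ Γ hΓ h) x) ((c' : Π h, W hHD hI hU h₃ Γ hΓ h) x) =
        B (Γ.conj x' hΓ) ((c : Π h, W hHD hI hU h₃ Γ hΓ h) x') ((c' : Π h, W hHD hI hU h₃ Γ hΓ h) x'))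
    (hS3 : ∀ {Γ : Level V} (hΓ : Γ.BelowConjThree) (g : V.adelicFin) (c c' : towerLevel hHD hI hU h₃ hA Γ hΓ) (x : V.adelicFin),
      B ((Γ.conj g hΓ).conj x (hΓ.conj g))
          ((translate hHD hI hU h₃ hA hΓ g c : Π h, W hHD hI hU h₃ (Γ.conj g hΓ) (hΓ.conj g) h) x)
          ((translate hHD hI hU h₃ hA hΓ g c' : Π h, W hHD hI hU h₃ (Γ.conj g hΓ) (hΓ.conj g) h) x) =
        B (Γ.conj (x * g) hΓ) ((c : Π h, W hHD hI hU h₃ Γ hΓ h) (x * g)) ((c' : Π h, W hHD hI hU h₃ Γ hΓ h) (x * g)))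
    {Γ : Level V} (hΓ : Γ.BelowConjThree) (g : V.adelicFin) (c c' : towerLevel hHD hI hU h₃ hA Γ hΓ)
    [Fintype (DoubleCoset.Quotient (((ρ V).range : Subgroup V.adelicFin) : Set V.adelicFin) (Γ.K : Set V.adelicFin))]
    [Fintype (DoubleCoset.Quotient (((ρ V).range : Subgroup V.adelicFin) : Set V.adelicFin) ((Γ.conj g hΓ).K : Set V.adelicFin))] :
    ∑ q : DoubleCoset.Quotient (((ρ V).range : Subgroup V.adelicFin) : Set V.adelicFin) ((Γ.conj g hΓ).K : Set V.adelicFin),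
        ((classWeight (ρ V).range Δ₀.K (Γ.conj g hΓ).K q.out : ℚ) : ℂ) *
          B ((Γ.conj g hΓ).conj q.out (hΓ.conj g))
            ((translate hHD hI hU h₃ hA hΓ g c : Π h, W hHD hI hU h₃ (Γ.conj g hΓ) (hΓ.conj g) h) q.out)
            ((translate hHD hI hU h₃ hA hΓ g c' : Π h, W hHD hI hU h₃ (Γ.conj g hΓ) (hΓ.conj g) h) q.out) =
      ∑ q : DoubleCoset.Quotient (((ρ V).range : Subgroup V.adelicFin) : Set V.adelicFin) (Γ.K : Set V.adelicFin),
        ((classWeight (ρ V).range Δ₀.K Γ.K q.out : ℚ) : ℂ) *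
          B (Γ.conj q.out hΓ) ((c : Π h, W hHD hI hU h₃ Γ hΓ h) q.out) ((c' : Π h, W hHD hI hU h₃ Γ hΓ h) q.out) := by
  have h1 : ∀ q : DoubleCoset.Quotient (((ρ V).range : Subgroup V.adelicFin) : Set V.adelicFin) ((Γ.conj g hΓ).K : Set V.adelicFin),
      ((classWeight (ρ V).range Δ₀.K (Γ.conj g hΓ).K q.out : ℚ) : ℂ) *
          B ((Γ.conj g hΓ).conj q.out (hΓ.conj g))
            ((translate hHD hI hU h₃ hA hΓ g c : Π h, W hHD hI hU h₃ (Γ.conj g hΓ) (hΓ.conj g) h) q.out)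
            ((translate hHD hI hU h₃ hA hΓ g c' : Π h, W hHD hI hU h₃ (Γ.conj g hΓ) (hΓ.conj g) h) q.out) =
        (fun y : V.adelicFin => ((classWeight (ρ V).range Δ₀.K Γ.K y : ℚ) : ℂ) *
          B (Γ.conj y hΓ) ((c : Π h, W hHD hI hU h₃ Γ hΓ h) y) ((c' : Π h, W hHD hI hU h₃ Γ hΓ h) y)) (q.out * g) := by
    intro q
    simp only
    rw [hS3 hΓ g c c' q.out, classWeight_level_conj V hL Δ₀ Γ hΓ g q.out]
  rw [Finset.sum_congr rfl (fun q _ => h1 q)]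
  refine sum_classSet_translate V Γ hΓ g
    (fun y : V.adelicFin => ((classWeight (ρ V).range Δ₀.K Γ.K y : ℚ) : ℂ) *
      B (Γ.conj y hΓ) ((c : Π h, W hHD hI hU h₃ Γ hΓ h) y) ((c' : Π h, W hHD hI hU h₃ Γ hΓ h) y)) (fun y u hu k hk => ?_)
  obtain ⟨γ, rfl⟩ := hu
  have r : Rel Γ γ y (ρ V γ * y * k) := ⟨k, hk, rfl⟩
  rw [classWeight_level_rel V hL Δ₀ r, ← hS1 hΓ c c' r]

/-- **(hsymm) The weighted level sums are Hermitian** (the weights are rational, hence real, and each `B_Δ` is Hermitian (S4a)).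
[cite: VoisinHodgeI2002, §6.3.2 Thm. 6.32] -/
theorem levelSum_symm (Δ₀ : Level V) (hS4a : ∀ (Δ : Level V) (α β : Coh hHD hI hU h₃ Δ 1), B Δ α β = conj (B Δ β α))
    {Γ : Level V} (hΓ : Γ.BelowConjThree) (c c' : towerLevel hHD hI hU h₃ hA Γ hΓ)
    [Fintype (DoubleCoset.Quotient (((ρ V).range : Subgroup V.adelicFin) : Set V.adelicFin) (Γ.K : Set V.adelicFin))] :
    ∑ q : DoubleCoset.Quotient (((ρ V).range : Subgroup V.adelicFin) : Set V.adelicFin) (Γ.K : Set V.adelicFin),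
        ((classWeight (ρ V).range Δ₀.K Γ.K q.out : ℚ) : ℂ) *
          B (Γ.conj q.out hΓ) ((c : Π h, W hHD hI hU h₃ Γ hΓ h) q.out) ((c' : Π h, W hHD hI hU h₃ Γ hΓ h) q.out) =
      conj (∑ q : DoubleCoset.Quotient (((ρ V).range : Subgroup V.adelicFin) : Set V.adelicFin) (Γ.K : Set V.adelicFin),
        ((classWeight (ρ V).range Δ₀.K Γ.K q.out : ℚ) : ℂ) *
          B (Γ.conj q.out hΓ) ((c' : Π h, W hHD hI hU h₃ Γ hΓ h) q.out) ((c : Π h, W hHD hI hU h₃ Γ hΓ h) q.out)) := by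
  rw [map_sum]
  refine Finset.sum_congr rfl (fun q _ => ?_)
  rw [map_mul, map_ratCast, ← hS4a]

set_option maxHeartbeats 400000 in
/-- **(hpos) The weighted level sums are positive definite**: every term has non-negative real part (weights `> 0` (W0), `B_Δ` positive (S4b)),
and if `c ≠ 0` some component `c_h ≠ 0`, whence `c_{q.out} ≠ 0` for the class `q` of `h` (`c_h = t_γ^* c_{q.out}`, `apply_eq_trPull`), so
that term is positive. [cite: VoisinHodgeI2002, §6.3.2 Thm. 6.32] -/
theorem levelSum_pos (Δ₀ : Level V) (hS4b : ∀ (Δ : Level V) (α : Coh hHD hI hU h₃ Δ 1), α ≠ 0 → 0 < (B Δ α α).re)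
    {Γ : Level V} (hΓ : Γ.BelowConjThree) (c : towerLevel hHD hI hU h₃ hA Γ hΓ) (hc : c ≠ 0)
    [Fintype (DoubleCoset.Quotient (((ρ V).range : Subgroup V.adelicFin) : Set V.adelicFin) (Γ.K : Set V.adelicFin))] :
    0 < (∑ q : DoubleCoset.Quotient (((ρ V).range : Subgroup V.adelicFin) : Set V.adelicFin) (Γ.K : Set V.adelicFin),
        ((classWeight (ρ V).range Δ₀.K Γ.K q.out : ℚ) : ℂ) *
          B (Γ.conj q.out hΓ) ((c : Π h, W hHD hI hU h₃ Γ hΓ h) q.out) ((c : Π h, W hHD hI hU h₃ Γ hΓ h) q.out)).re := by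
  classical
  rw [Complex.re_sum]
  -- a nonzero component, and the representative of its class
  have hex : ∃ h : V.adelicFin, (c : Π h, W hHD hI hU h₃ Γ hΓ h) h ≠ 0 := by
    by_contra hall
    exact hc (Subtype.ext (funext fun x => not_not.mp (not_exists.mp hall x)))
  obtain ⟨h, hh⟩ := hex
  obtain ⟨u, k, hu, hk, he⟩ := DoubleCoset.mk_out_eq_mul (ρ V).range Γ.K h
  obtain ⟨γ, rfl⟩ := hu
  have r : Rel Γ γ h (DoubleCoset.mk (ρ V).range Γ.K h).out := ⟨k, hk, he⟩
  have hq₀ : (c : Π h, W hHD hI hU h₃ Γ hΓ h) (DoubleCoset.mk (ρ V).range Γ.K h).out ≠ 0 := by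
    intro h0
    apply hh
    rw [apply_eq_trPull hHD hI hU h₃ hA c r (transCond_of_rel hΓ r), h0, map_zero]
  -- real parts of the terms
  have hre : ∀ q : DoubleCoset.Quotient (((ρ V).range : Subgroup V.adelicFin) : Set V.adelicFin) (Γ.K : Set V.adelicFin),
      (((classWeight (ρ V).range Δ₀.K Γ.K q.out : ℚ) : ℂ) *
          B (Γ.conj q.out hΓ) ((c : Π h, W hHD hI hU h₃ Γ hΓ h) q.out) ((c : Π h, W hHD hI hU h₃ Γ hΓ h) q.out)).re =
        (classWeight (ρ V).range Δ₀.K Γ.K q.out : ℝ) *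
          (B (Γ.conj q.out hΓ) ((c : Π h, W hHD hI hU h₃ Γ hΓ h) q.out) ((c : Π h, W hHD hI hU h₃ Γ hΓ h) q.out)).re := by
    intro q
    rw [Complex.mul_re, Complex.ratCast_re, Complex.ratCast_im, zero_mul, sub_zero]
  refine Finset.sum_pos' (fun q _ => ?_) ⟨DoubleCoset.mk (ρ V).range Γ.K h, Finset.mem_univ _, ?_⟩
  · rw [hre]
    refine mul_nonneg (by exact_mod_cast (classWeight_level_pos V Δ₀ Γ q.out).le) ?_
    by_cases h0 : (c : Π h, W hHD hI hU h₃ Γ hΓ h) q.out = 0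
    · rw [h0]
      simp
    · exact (hS4b _ _ h0).le
  · rw [hre]
    exact mul_pos (by exact_mod_cast classWeight_level_pos V Δ₀ Γ _) (hS4b _ _ hq₀)

/-! ## §2 The level forms and the invariant Hermitian form on the tower -/

set_option maxHeartbeats 400000 in
/-- Additivity of the weighted level sum in the first variable. [cite: VoisinHodgeI2002, §6.3.2 Thm. 6.32] -/
theorem levelSum_add_left (Δ₀ : Level V) {Γ : Level V} (hΓ : Γ.BelowConjThree) (c₁ c₂ c' : towerLevel hHD hI hU h₃ hA Γ hΓ)
    [Fintype (DoubleCoset.Quotient (((ρ V).range : Subgroup V.adelicFin) : Set V.adelicFin) (Γ.K : Set V.adelicFin))] :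
    ∑ q : DoubleCoset.Quotient (((ρ V).range : Subgroup V.adelicFin) : Set V.adelicFin) (Γ.K : Set V.adelicFin),
        ((classWeight (ρ V).range Δ₀.K Γ.K q.out : ℚ) : ℂ) *
          B (Γ.conj q.out hΓ) (((c₁ + c₂ : towerLevel hHD hI hU h₃ hA Γ hΓ) : Π h, W hHD hI hU h₃ Γ hΓ h) q.out) ((c' : Π h, W hHD hI hU h₃ Γ hΓ h) q.out) =
      ∑ q : DoubleCoset.Quotient (((ρ V).range : Subgroup V.adelicFin) : Set V.adelicFin) (Γ.K : Set V.adelicFin),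
        ((classWeight (ρ V).range Δ₀.K Γ.K q.out : ℚ) : ℂ) *
          B (Γ.conj q.out hΓ) ((c₁ : Π h, W hHD hI hU h₃ Γ hΓ h) q.out) ((c' : Π h, W hHD hI hU h₃ Γ hΓ h) q.out) +
      ∑ q : DoubleCoset.Quotient (((ρ V).range : Subgroup V.adelicFin) : Set V.adelicFin) (Γ.K : Set V.adelicFin),
        ((classWeight (ρ V).range Δ₀.K Γ.K q.out : ℚ) : ℂ) *
          B (Γ.conj q.out hΓ) ((c₂ : Π h, W hHD hI hU h₃ Γ hΓ h) q.out) ((c' : Π h, W hHD hI hU h₃ Γ hΓ h) q.out) := by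
  rw [← Finset.sum_add_distrib]
  refine Finset.sum_congr rfl (fun q _ => ?_)
  rw [Submodule.coe_add, Pi.add_apply, map_add, LinearMap.add_apply, mul_add]

/-- Conjugate-linearity of the weighted level sum in the first variable. [cite: VoisinHodgeI2002, §6.3.2 Thm. 6.32] -/
theorem levelSum_smul_left (Δ₀ : Level V) {Γ : Level V} (hΓ : Γ.BelowConjThree) (a : ℂ) (c c' : towerLevel hHD hI hU h₃ hA Γ hΓ)
    [Fintype (DoubleCoset.Quotient (((ρ V).range : Subgroup V.adelicFin) : Set V.adelicFin) (Γ.K : Set V.adelicFin))] :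
    ∑ q : DoubleCoset.Quotient (((ρ V).range : Subgroup V.adelicFin) : Set V.adelicFin) (Γ.K : Set V.adelicFin),
        ((classWeight (ρ V).range Δ₀.K Γ.K q.out : ℚ) : ℂ) *
          B (Γ.conj q.out hΓ) (((a • c : towerLevel hHD hI hU h₃ hA Γ hΓ) : Π h, W hHD hI hU h₃ Γ hΓ h) q.out) ((c' : Π h, W hHD hI hU h₃ Γ hΓ h) q.out) =
      conj a * ∑ q : DoubleCoset.Quotient (((ρ V).range : Subgroup V.adelicFin) : Set V.adelicFin) (Γ.K : Set V.adelicFin),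
        ((classWeight (ρ V).range Δ₀.K Γ.K q.out : ℚ) : ℂ) *
          B (Γ.conj q.out hΓ) ((c : Π h, W hHD hI hU h₃ Γ hΓ h) q.out) ((c' : Π h, W hHD hI hU h₃ Γ hΓ h) q.out) := by
  rw [Finset.mul_sum]
  refine Finset.sum_congr rfl (fun q _ => ?_)
  rw [Submodule.coe_smul, Pi.smul_apply, LinearMap.map_smulₛₗ, LinearMap.smul_apply, smul_eq_mul]
  ring

/-- Additivity of the weighted level sum in the second variable. [cite: VoisinHodgeI2002, §6.3.2 Thm. 6.32] -/
theorem levelSum_add_right (Δ₀ : Level V) {Γ : Level V} (hΓ : Γ.BelowConjThree) (c c'₁ c'₂ : towerLevel hHD hI hU h₃ hA Γ hΓ)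
    [Fintype (DoubleCoset.Quotient (((ρ V).range : Subgroup V.adelicFin) : Set V.adelicFin) (Γ.K : Set V.adelicFin))] :
    ∑ q : DoubleCoset.Quotient (((ρ V).range : Subgroup V.adelicFin) : Set V.adelicFin) (Γ.K : Set V.adelicFin),
        ((classWeight (ρ V).range Δ₀.K Γ.K q.out : ℚ) : ℂ) *
          B (Γ.conj q.out hΓ) ((c : Π h, W hHD hI hU h₃ Γ hΓ h) q.out) (((c'₁ + c'₂ : towerLevel hHD hI hU h₃ hA Γ hΓ) : Π h, W hHD hI hU h₃ Γ hΓ h) q.out) =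
      ∑ q : DoubleCoset.Quotient (((ρ V).range : Subgroup V.adelicFin) : Set V.adelicFin) (Γ.K : Set V.adelicFin),
        ((classWeight (ρ V).range Δ₀.K Γ.K q.out : ℚ) : ℂ) *
          B (Γ.conj q.out hΓ) ((c : Π h, W hHD hI hU h₃ Γ hΓ h) q.out) ((c'₁ : Π h, W hHD hI hU h₃ Γ hΓ h) q.out) +
      ∑ q : DoubleCoset.Quotient (((ρ V).range : Subgroup V.adelicFin) : Set V.adelicFin) (Γ.K : Set V.adelicFin),
        ((classWeight (ρ V).range Δ₀.K Γ.K q.out : ℚ) : ℂ) *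
          B (Γ.conj q.out hΓ) ((c : Π h, W hHD hI hU h₃ Γ hΓ h) q.out) ((c'₂ : Π h, W hHD hI hU h₃ Γ hΓ h) q.out) := by
  rw [← Finset.sum_add_distrib]
  refine Finset.sum_congr rfl (fun q _ => ?_)
  rw [Submodule.coe_add, Pi.add_apply, map_add, mul_add]

/-- Linearity of the weighted level sum in the second variable. [cite: VoisinHodgeI2002, §6.3.2 Thm. 6.32] -/
theorem levelSum_smul_right (Δ₀ : Level V) {Γ : Level V} (hΓ : Γ.BelowConjThree) (a : ℂ) (c c' : towerLevel hHD hI hU h₃ hA Γ hΓ)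
    [Fintype (DoubleCoset.Quotient (((ρ V).range : Subgroup V.adelicFin) : Set V.adelicFin) (Γ.K : Set V.adelicFin))] :
    ∑ q : DoubleCoset.Quotient (((ρ V).range : Subgroup V.adelicFin) : Set V.adelicFin) (Γ.K : Set V.adelicFin),
        ((classWeight (ρ V).range Δ₀.K Γ.K q.out : ℚ) : ℂ) *
          B (Γ.conj q.out hΓ) ((c : Π h, W hHD hI hU h₃ Γ hΓ h) q.out) (((a • c' : towerLevel hHD hI hU h₃ hA Γ hΓ) : Π h, W hHD hI hU h₃ Γ hΓ h) q.out) =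
      a * ∑ q : DoubleCoset.Quotient (((ρ V).range : Subgroup V.adelicFin) : Set V.adelicFin) (Γ.K : Set V.adelicFin),
        ((classWeight (ρ V).range Δ₀.K Γ.K q.out : ℚ) : ℂ) *
          B (Γ.conj q.out hΓ) ((c : Π h, W hHD hI hU h₃ Γ hΓ h) q.out) ((c' : Π h, W hHD hI hU h₃ Γ hΓ h) q.out) := by
  rw [Finset.mul_sum]
  refine Finset.sum_congr rfl (fun q _ => ?_)
  rw [Submodule.coe_smul, Pi.smul_apply, LinearMap.map_smul, smul_eq_mul]
  ring

/-- **The weighted level sums are sesquilinear**: for each level there is a sesquilinear map `B_Γ` on `H_K = towerLevel Γ` with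
`B_Γ c c' = Σ_q w_Γ(q) · B_{Γ_q}(c_q, c'_q)`. [cite: VoisinHodgeI2002, §6.3.2 Thm. 6.32] -/
theorem exists_levelForm (Δ₀ : Level V) (Γ : Level V) (hΓ : Γ.BelowConjThree)
    [Fintype (DoubleCoset.Quotient (((ρ V).range : Subgroup V.adelicFin) : Set V.adelicFin) (Γ.K : Set V.adelicFin))] :
    ∃ BΓ : ↥(towerLevel hHD hI hU h₃ hA Γ hΓ) →ₗ⋆[ℂ] ↥(towerLevel hHD hI hU h₃ hA Γ hΓ) →ₗ[ℂ] ℂ,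
      ∀ c c' : towerLevel hHD hI hU h₃ hA Γ hΓ, BΓ c c' =
        ∑ q : DoubleCoset.Quotient (((ρ V).range : Subgroup V.adelicFin) : Set V.adelicFin) (Γ.K : Set V.adelicFin),
        ((classWeight (ρ V).range Δ₀.K Γ.K q.out : ℚ) : ℂ) *
          B (Γ.conj q.out hΓ) ((c : Π h, W hHD hI hU h₃ Γ hΓ h) q.out) ((c' : Π h, W hHD hI hU h₃ Γ hΓ h) q.out) :=
  ⟨LinearMap.mk₂'ₛₗ (starRingEnd ℂ) (RingHom.id ℂ)
    (fun c c' => ∑ q : DoubleCoset.Quotient (((ρ V).range : Subgroup V.adelicFin) : Set V.adelicFin) (Γ.K : Set V.adelicFin),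
        ((classWeight (ρ V).range Δ₀.K Γ.K q.out : ℚ) : ℂ) *
          B (Γ.conj q.out hΓ) ((c : Π h, W hHD hI hU h₃ Γ hΓ h) q.out) ((c' : Π h, W hHD hI hU h₃ Γ hΓ h) q.out))
    (fun c₁ c₂ c' => levelSum_add_left hHD hI hU h₃ hA V B Δ₀ hΓ c₁ c₂ c')
    (fun a c c' => levelSum_smul_left hHD hI hU h₃ hA V B Δ₀ hΓ a c c')
    (fun c c'₁ c'₂ => levelSum_add_right hHD hI hU h₃ hA V B Δ₀ hΓ c c'₁ c'₂)
    (fun a c c' => levelSum_smul_right hHD hI hU h₃ hA V B Δ₀ hΓ a c c'), fun _ _ => rfl⟩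

/-- **MAIN — the tower representation is unitarizable.**  For `[L:ℚ] ≠ 2` (finite class sets, cocompact levels), `V.Hm` anisotropic, and the
Kähler-class system `hΩ` (row B3-25), the tower `H = colim_K H¹(X_K(ℂ); ℂ)` of `(L, ι₁, V)` — as the representation `Representation.ofModule'` of the
`ℂ[U(V)(𝔸_f)]`-module `Tower … V`, which IS `towerRep` (`ofModule'_tower_eq_towerRep`) and is the field `rhoB τ'` of the `h413` datum — carries a
`U(V)(𝔸_{L₀,f})`-invariant positive-definite Hermitian form: the colimit (p599036 `exists_invariantForm_towerRep`) of the weighted level forms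
`B_Γ = Σ_q w_Γ(q) · HR_{X_{Γ_q}, ω}` of the `ω`-normalised Hodge–Riemann forms (`exists_hrFormFamily`), `w_Γ = classWeight U(V)(L₀) K_f(3) K_Γ`
(covolume × volume weights; input (III) = the lattice theorem `CocompactLattice.relIndex_map_conj_eq`; the modular ratio is `1` by the mass trick).
This is the body of the registered stub `stub_unitarizableAtPin` of line `a3-liu413`, conditional on `hΩ` only.
[cite: Liu2021, Prop. 4.13 proof l. 2121–2131] [cite: VoisinHodgeI2002, §6.3.2 Thm. 6.32] [cite: ShimuraIATAF1971, §3.3 Prop. 3.6] -/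
theorem isUnitarizable_ofModule'_tower (hL : Module.finrank ℚ L ≠ 2) (h : IsAnisotropic L V.Hm) (hΩ : BallQuotientKaehlerClassSystem) :
    Representation.IsUnitarizable (G := ↥V.adelicFin) (V := Tower hHD hI hU h₃ hA V)
      (Representation.ofModule' (k := ℂ) (G := ↥V.adelicFin) (Tower hHD hI hU h₃ hA V)) := by
  classical
  rw [ofModule'_tower_eq_towerRep]
  obtain ⟨B, hB⟩ := exists_hrFormFamily hHD hI hU h₃ (V := V) hΩ
  haveI : ∀ Δ : Level V, Fintype (DoubleCoset.Quotient (((ρ V).range : Subgroup V.adelicFin) : Set V.adelicFin) (Δ.K : Set V.adelicFin)) :=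
    fun Δ => @Fintype.ofFinite _ (HermSpace3.finite_doubleCoset_range_ρ V hL Δ.K Δ.isOpen_K)
  -- the level forms, with reference level `K_f(3)`
  have hform := fun (Γ : Level V) (hΓ : Γ.BelowConjThree) => exists_levelForm hHD hI hU h₃ hA V B (Level.three V) Γ hΓ
  choose BΓ hBΓ using hform
  -- (S1) once and for all
  have hS1 : ∀ {Γ : Level V} (hΓ : Γ.BelowConjThree) (c c' : towerLevel hHD hI hU h₃ hA Γ hΓ) {γ : ↥(Urat V)} {x x' : V.adelicFin},
      Rel Γ γ x x' → B (Γ.conj x hΓ) ((c : Π h, W hHD hI hU h₃ Γ hΓ h) x) ((c' : Π h, W hHD hI hU h₃ Γ hΓ h) x) =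
        B (Γ.conj x' hΓ) ((c : Π h, W hHD hI hU h₃ Γ hΓ h) x') ((c' : Π h, W hHD hI hU h₃ Γ hΓ h) x') :=
    fun hΓ c c' _ _ _ r => hrForm_apply_eq_of_rel hHD hI hU h₃ hA hΩ B hB h hΓ c c' r
  obtain ⟨Binf, -, hs, hp, hinv⟩ := Summit.HodgeConjecture.CorCM.Lines.A3Liu413.exists_invariantForm_towerRep hHD hI hU h₃ hA BΓ
    (fun hle hΓ hΓ' c c' => by
      rw [hBΓ, hBΓ]
      exact levelSum_restrict hHD hI hU h₃ hA V B hL (Level.three V) hS1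
        (fun hle hΓ hΓ' c c' x => hrForm_restrictLevel_apply hHD hI hU h₃ hA hΩ B hB h hle hΓ hΓ' c c' x) hle hΓ hΓ' c c')
    (fun Γ hΓ c c' => by
      rw [hBΓ, hBΓ]
      exact levelSum_symm hHD hI hU h₃ hA V B (Level.three V) (fun Δ α β => hrForm_symm hHD hI hU h₃ hΩ B hB Δ α β) hΓ c c')
    (fun Γ hΓ c hc => by
      rw [hBΓ]
      exact levelSum_pos hHD hI hU h₃ hA V B (Level.three V) (fun Δ α hα => hrForm_posDef hHD hI hU h₃ hΩ B hB h Δ α hα) hΓ c hc)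
    (fun Γ hΓ g c c' => by
      rw [hBΓ, hBΓ]
      exact levelSum_translate hHD hI hU h₃ hA V B hL (Level.three V) hS1
        (fun hΓ g c c' x => hrForm_translate_apply hHD hI hU h₃ hA hΩ B hB h hΓ g c c' x) hΓ g c c')
  exact ⟨Binf, LinearMap.isSymm_def.mpr (fun v w => by rw [hs v w]; exact Complex.conj_conj _), hp, hinv⟩

end Model.TowerLevel

end HodgeCM

end
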